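import Literature.NumberTheory.ComplexMultiplication.TorsionReciprocityReduction
import HarnessLib

/-!
# Thm. 19.11 («`α(𝔬_v^×) = 1` ⟺ good reduction») from the INERTIA form of Néron–Ogg–Šafarevič
# (consumer-side VI-NOS edition of the cell `hodgecm-mathlib`; [Shimura 1998, Thm. 19.11, Lemma 19.5; Serre–Tate 1968 §1 Thm. 1])

Topic `Literature/NumberTheory/ComplexMultiplication`, namespace `Literature.NumberTheory.ComplexMultiplication`.  THEOREMS ONLY
(no definition, no named fact, no instance; net Literature debt **0**).

The tree's `forall_localUnits_eq_one_of_hasGoodReductionAt_of_torsionReciprocity` (A-p03, `TorsionReciprocityReduction.lean` :245)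
consumes the two reduction-theory NAMED FACTS `AbelianVariety.nonempty_goodReductionAt A₀ v` (Néron-model DATUM from a bare smooth
proper model) and `GoodReductionAt.nonempty_tateSpecialisation R ℓ` (the `ℓ`-adic specialisation DATUM of an ARBITRARY datum `R`), but
its proof uses of them only: a prime `𝔓 ∣ v` of `ℤ̄_k` and «the inertia group `I_𝔓` acts trivially on `T_ℓ A₀`» for one prime
`ℓ ∤ v` (the consumer trace of the cell, 2026-08-28T07:5xZ: fields `T.prime`, `T.prime_mem`, `T.tateRep_eq_one_of_mem_inertia` and
nothing else).  That is the EASY direction of the criterion of Néron–Ogg–Šafarevič ([SerreTate1968] §1 Thm. 1; [Shimura1998]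
Lemma 19.5 «a prime ideal `𝔭` in `k` prime to `ℓ` is always unramified in `k^{(ℓ)}`» when `A` has good reduction modulo `𝔭`).
This file re-proves the two statements of Thm. 19.11 with that single hypothesis

  `h₁₂ : HasGoodReductionAt A₀.X A₀.dim v → ∀ (ℓ : ℕ) [Fact ℓ.Prime], (ℓ : 𝓞 k) ∉ v.asIdeal →
          ∃ 𝔓 ∈ v.primesAbove, ∀ σ ∈ 𝔓.inertia (Field.absoluteGaloisGroup k), A₀.tateRep ℓ σ = 1`

in place of `(h₁, h₂)`, so that the `h21` cone can be fed EITHER by today's named facts (bridge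
`forall_inertia_tateRep_eq_one_of_nonempty_goodReductionAt`) OR, later, by the abelian-scheme-model road (finite-étale `ℓⁿ`-torsion of a
Néron model ⇒ inertia acts trivially) without touching any statement downstream.  Proof bodies are A-p03's, character for character,
except for the three lines that chose `R` and `T`.  HC_CM is proved only modulo the 7 printed citations until rung 0 closes; this file
adds no hypothesis to anything.

## References
* [Shimura1998] G. Shimura, *Abelian Varieties with Complex Multiplication and Modular Functions* (1998): Thm. 19.11 (first assertion)
  p. 138, Prop. 19.9 p. 136, Lemma 19.5 p. 133, Thm. 19.8 p. 134.
* [SerreTate1968] J.-P. Serre, J. Tate, *Good reduction of abelian varieties*, Ann. of Math. 88 (1968), §1 Thm. 1; §7 Thm. 11 Cor. 1.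
* [LangANT1994] S. Lang, *Algebraic Number Theory*, 2nd ed., Ch. XI §4 Thm. 4.
* [Milne1986AbelianVarieties] J. S. Milne, *Abelian varieties*, in Cornell–Silverman (1986), Lemma 12.2.
-/

noncomputable section

open CategoryTheory IsDedekindDomain NumberField
open scoped NumberField nonZeroDivisors

namespace Literature.NumberTheory.ComplexMultiplication

open Literature.AlgebraicGeometry.Motives
open Literature.NumberTheory.GaloisRepresentations
open Literature.NumberTheory.NumberFields.IdeleAction (ideleMulIdeal ideleMulEquiv)
open Literature.NumberTheory.AdelicBaseChange (ideleRelNorm)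
open Literature.NumberTheory.Automorphic.FiniteAdeleRing (toFractionalIdeal)

/-! ## §1. Plumbing (local copies of A-p03's private helpers) -/

section Plumbing

variable {k : Type} [Field k]

/-- **There is a rational prime `ℓ` with `v ∤ ℓ`** (`𝔭_v ≠ (1)` contains at most one of `2`, `3`). [folklore] -/
private theorem exists_prime_natCast_not_mem' [NumberField k] (v : HeightOneSpectrum (𝓞 k)) :
    ∃ ℓ : ℕ, ℓ.Prime ∧ (ℓ : 𝓞 k) ∉ v.asIdeal := by
  by_contra h
  push Not at h
  have h2 : ((2 : ℕ) : 𝓞 k) ∈ v.asIdeal := h 2 Nat.prime_two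
  have h3 : ((3 : ℕ) : 𝓞 k) ∈ v.asIdeal := h 3 Nat.prime_three
  have h1 : (1 : 𝓞 k) ∈ v.asIdeal := by
    have e : ((3 : ℕ) : 𝓞 k) - ((2 : ℕ) : 𝓞 k) = 1 := by norm_num
    rw [← e]
    exact v.asIdeal.sub_mem h3 h2
  exact v.isPrime.ne_top ((Ideal.eq_top_iff_one _).mpr h1)

/-- `ℓⁿ ∉ 𝔭_v` when `ℓ ∉ 𝔭_v` (`𝔭_v` is prime). [folklore] -/
private theorem pow_natCast_not_mem' [NumberField k] {v : HeightOneSpectrum (𝓞 k)} {ℓ : ℕ} (hℓ : (ℓ : 𝓞 k) ∉ v.asIdeal)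
    (n : ℕ) : ((ℓ ^ n : ℕ) : 𝓞 k) ∉ v.asIdeal := fun h =>
  hℓ (v.isPrime.mem_of_pow_mem n (by rwa [← Nat.cast_pow]))

/-- A unit of `𝒪_v` has valuation `1` in `k_v`. [folklore] -/
private theorem valuation_unitsMap_subtype_eq_one' [NumberField k] {v : HeightOneSpectrum (𝓞 k)}
    (w : (v.adicCompletionIntegers k)ˣ) :
    Valued.v ((Units.map ((v.adicCompletionIntegers k).subtype : _ →* _) w :
      (v.adicCompletion k)ˣ) : v.adicCompletion k) = 1 := by
  change Valued.v ((w : v.adicCompletionIntegers k) : v.adicCompletion k) = 1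
  exact Valuation.Integers.one_of_isUnit (Valuation.integer.integers _) w.isUnit

variable {K : Type} [Field K] [NumberField K]

/-- **A fractional ideal of a number field `K` is not all of `K`.** [folklore] -/
private theorem exists_not_mem_fractionalIdeal' (𝔞 : FractionalIdeal (𝓞 K)⁰ K) : ∃ x : K, x ∉ 𝔞 := by
  by_contra h
  push Not at h
  obtain ⟨d, hd, hint⟩ := 𝔞.isFractional
  have hd0 : algebraMap (𝓞 K) K d ≠ 0 := IsFractionRing.to_map_ne_zero_of_mem_nonZeroDivisors hd
  have hsurj : Function.Surjective (algebraMap (𝓞 K) K) := fun y => by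
    obtain ⟨c, hc⟩ := hint ((algebraMap (𝓞 K) K d)⁻¹ * y) (h _)
    refine ⟨c, ?_⟩
    rw [hc, Algebra.smul_def, ← mul_assoc, mul_inv_cancel₀ hd0, one_mul]
  exact RingOfIntegers.not_isField K (MulEquiv.isField (Field.toIsField K)
    (RingEquiv.ofBijective (algebraMap (𝓞 K) K) ⟨IsFractionRing.injective (𝓞 K) K, hsurj⟩).toMulEquiv)

end Plumbing

/-! ## §2. The bridge from today's named facts -/

section Bridge

variable {k : Type} [Field k] [NumberField k] {A₀ : AbelianVariety k} {v : HeightOneSpectrum (𝓞 k)}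

/-- **Today's two reduction-theory named facts imply the inertia hypothesis** ([Shimura1998] Lemma 19.5 / [SerreTate1968] §1 Thm. 1,
easy direction): from the Néron-model datum `nonempty_goodReductionAt A₀ v` and the `ℓ`-adic specialisation data
`GoodReductionAt.nonempty_tateSpecialisation` one gets, at a place of good reduction and for every prime `ℓ ∤ v`, a prime `𝔓 ∣ v` of
`ℤ̄_k` whose inertia group acts trivially on `T_ℓ A₀` (fields `prime`, `prime_mem`, `tateRep_eq_one_of_mem_inertia` of the datum).
[cite: Shimura1998, Lemma 19.5 p. 133] [cite: SerreTate1968, §1 Thm. 1] -/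
theorem forall_inertia_tateRep_eq_one_of_nonempty_goodReductionAt
    (h₁ : AbelianVariety.nonempty_goodReductionAt A₀ v)
    (h₂ : ∀ R : A₀.GoodReductionAt v, ∀ (ℓ : ℕ) [Fact ℓ.Prime], R.nonempty_tateSpecialisation ℓ)
    (hgood : HasGoodReductionAt A₀.X A₀.dim v) (ℓ : ℕ) [Fact ℓ.Prime] (hℓ : (ℓ : 𝓞 k) ∉ v.asIdeal) :
    ∃ 𝔓 ∈ v.primesAbove, ∀ σ ∈ 𝔓.inertia (Field.absoluteGaloisGroup k), A₀.tateRep ℓ σ = 1 := by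
  obtain ⟨R⟩ := h₁ hgood
  obtain ⟨T⟩ := h₂ R ℓ hℓ
  exact ⟨T.prime, T.prime_mem, fun _ hσ => T.tateRep_eq_one_of_mem_inertia hσ⟩

end Bridge

/-! ## §3. Thm. 19.11 (first assertion) from the inertia hypothesis -/

section Main

variable {k : Type} [Field k] [NumberField k] [Algebra k ℂ] {K : Type} [Field K] [NumberField K]
  {Φ : CMType K} [NumberField ↥(traceField Φ)] [Algebra ↥(traceField Φ) k]
  {A₀ : AbelianVariety k} {ι₀ : 𝓞 K →+* End A₀} {𝔞 : (FractionalIdeal (𝓞 K)⁰ K)ˣ}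
  (ξ : CMTypeUniformization Φ 𝔞 (A₀.baseChange ℂ) ((A₀.endBaseChange ℂ).comp ι₀))
  (α : ideleGroup k →* Kˣ)

/-- **Shimura 1998 Thm. 19.11, first assertion, direction «good reduction modulo `𝔭` ⟹ `α(𝔬_𝔭^×) = 1`», from the INERTIA form of
Néron–Ogg–Šafarevič** (sibling of A-p03's `forall_localUnits_eq_one_of_hasGoodReductionAt_of_torsionReciprocity`, same proof):
for `u ∈ 𝔬_v^×` there is `γ` IN the inertia group `I_𝔓` of the prime `𝔓 ∣ v` supplied by `h₁₂` with `γ = [⟨u⟩_v, k]` on `k_ab`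
(Lang XI §4 Thm. 4); with `b = α⟨u⟩_v`, reciprocity gives `ρ_ℓ(γ) = T_ℓ(ι₀ b)`, `h₁₂` gives `ρ_ℓ(γ) = 1`, `T_ℓ` is faithful
(Milne 1986 Lemma 12.2), so `ι₀(b) = ι₀(1)`, `r(bw) = r(w)` for all `w ∈ K`, `(b - 1)K ⊆ 𝔞`, `b = 1`.
[cite: Shimura1998, Thm. 19.11 (first assertion) p. 136, §19.9 (≈ p. 135), Lemma 19.5 p. 133, Thm. 19.8 p. 134]
[cite: SerreTate1968, §7 Thm. 11 Cor. 1] [cite: LangANT1994, Ch. XI §4 Thm. 4] [cite: Milne1986AbelianVarieties, Lemma 12.2 (p. 189)] -/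
theorem forall_localUnits_eq_one_of_hasGoodReductionAt_of_torsionReciprocity_of_inertia
    (hrec : ∀ (σ : ℂ ≃ₐ[k] ℂ) (x : ideleGroup k), IsArtinLift k x σ → ∀ u v : K,
      ideleMulEquiv (FiniteAdeleRing.unitEmbedding (𝓞 K) K (α x) *
          (reflexNormFinitePart K Φ (traceField Φ) (ideleRelNorm (↥(traceField Φ)) k x))⁻¹)
        (𝔞 : FractionalIdeal (𝓞 K)⁰ K) 𝔞.ne_zero (Submodule.Quotient.mk u) = Submodule.Quotient.mk v →
      σ • (A₀.pointsMulEquiv ℂ).symm (ξ.r u) = (A₀.pointsMulEquiv ℂ).symm (ξ.r v))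
    {v : HeightOneSpectrum (𝓞 k)}
    (hαv : ∀ u : (v.adicCompletionIntegers k)ˣ, ∃ b : 𝓞 K,
      (b : K) = α (localUnits v (Units.map ((v.adicCompletionIntegers k).subtype : _ →* _) u)))
    (h₁₂ : HasGoodReductionAt A₀.X A₀.dim v → ∀ (ℓ : ℕ) [Fact ℓ.Prime], (ℓ : 𝓞 k) ∉ v.asIdeal →
      ∃ 𝔓 ∈ v.primesAbove, ∀ σ ∈ 𝔓.inertia (Field.absoluteGaloisGroup k), A₀.tateRep ℓ σ = 1)
    (hgood : HasGoodReductionAt A₀.X A₀.dim v) (u : (v.adicCompletionIntegers k)ˣ) :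
    α (localUnits v (Units.map ((v.adicCompletionIntegers k).subtype : _ →* _) u)) = 1 := by
  classical
  -- a prime `ℓ ∤ v` and a prime `𝔓 ∣ v` of `ℤ̄_k` whose inertia acts trivially on `T_ℓ A₀` (the hypothesis `h₁₂`)
  obtain ⟨ℓ, hℓp, hℓ⟩ := exists_prime_natCast_not_mem' v
  haveI : Fact ℓ.Prime := ⟨hℓp⟩
  obtain ⟨𝔓, h𝔓, hI⟩ := h₁₂ hgood ℓ hℓ
  -- CLASS FIELD THEORY: `[⟨u⟩_v, k]` is some `g` IN THE INERTIA GROUP of `𝔓 ∣ v`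
  obtain ⟨g, hgI, hgu⟩ :=
    NumberFields.exists_mem_inertia_absGaloisAbProj_eq_ideleArtinMap_localUnits h𝔓 u
  set z : (v.adicCompletion k)ˣ := Units.map ((v.adicCompletionIntegers k).subtype : _ →* _) u with hz
  have hz1 : Valued.v (z : v.adicCompletion k) ≤ 1 := (valuation_unitsMap_subtype_eq_one' u).le
  -- `α⟨u⟩_v = b ∈ 𝔬_K`
  obtain ⟨b, hb⟩ := hαv u
  -- extend `g` along `e : k̄ → ℂ` to `σ ∈ Aut(ℂ/k)`; then `σ = [⟨u⟩_v, k]` on `k_ab`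
  let e : AlgebraicClosure k →ₐ[k] ℂ := IsAlgClosed.lift
  obtain ⟨σ, hσ⟩ := exists_algEquiv_apply_eq_of_absoluteGaloisGroup k e g
  have hlift : IsArtinLift k (localUnits v z) σ := ⟨e, g, hσ, hgu⟩
  -- `ρ_ℓ(g) = T_ℓ(ι₀ b)`: reciprocity on `A₀[ℓⁿ](ℂ) = r(ℓ⁻ⁿ𝔞/𝔞)` («the `ℓ`-component of `f(⟨u⟩_v)` is `1`»), transferred to `k̄`
  have key : A₀.tateRep ℓ g = AbelianVariety.tateModuleMap ℓ (ι₀ b : A₀ ⟶ A₀) := by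
    refine Literature.AlgebraicGeometry.ComplexMultiplication.tateRep_eq_tateModuleMap_of_forall_smul_eq fun n P hP => ?_
    refine smul_eq_geomPointsMap_of_forall_torsionPoints_complex A₀ e σ g hσ (ι₀ b) _ (fun Q hQ => ?_) hP
    obtain ⟨w, hw𝔞, rfl⟩ := exists_pointsMulEquiv_symm_r_eq_of_mem_torsionPoints ξ (pow_ne_zero n hℓp.ne_zero) hQ
    rw [← pointsMulEquiv_symm_r_mul ξ b w]
    have hmk := ideleMulEquiv_unitEmbedding_mul_reflexNormFinitePart_inv_mk K Φ (traceField Φ) hz1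
      (pow_natCast_not_mem' hℓ n) (𝔞 : FractionalIdeal (𝓞 K)⁰ K) 𝔞.ne_zero (α (localUnits v z)) hw𝔞
    have h := hrec σ (localUnits v z) hlift w _ hmk
    rw [h, ← hb]
  -- inertia acts trivially on `T_ℓ A₀` at `𝔓`: `T_ℓ(ι₀ b) = 1 = T_ℓ(ι₀ 1)`, so `ι₀ b = ι₀ 1` (`T_ℓ` faithful)
  have hιb : (ι₀ b : A₀ ⟶ A₀) = (ι₀ 1 : A₀ ⟶ A₀) := by
    refine AbelianVariety.hom_ext_of_tateModuleMap_eq ℓ (Nat.cast_ne_zero.mpr hℓp.ne_zero) ?_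
    rw [← key, hI g hgI, map_one]
    exact (AbelianVariety.tateModuleMap_id ℓ A₀).symm
  -- hence `r(bw) = r(w)` for every `w ∈ K`, and `b = 1` since `𝔞 ≠ K`
  have hb1 : (b : K) = 1 := by
    obtain ⟨x, hx⟩ := exists_not_mem_fractionalIdeal' (𝔞 : FractionalIdeal (𝓞 K)⁰ K)
    by_contra hb1
    have hne : (b : K) - 1 ≠ 0 := sub_ne_zero.mpr hb1
    apply hx
    have hr : ξ.r ((b : K) * (((b : K) - 1)⁻¹ * x)) = ξ.r (((1 : 𝓞 K) : K) * (((b : K) - 1)⁻¹ * x)) := by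
      apply (A₀.pointsMulEquiv ℂ).symm.injective
      rw [pointsMulEquiv_symm_r_mul, pointsMulEquiv_symm_r_mul, hιb]
    rw [RingOfIntegers.coe_eq_algebraMap 1, map_one, one_mul, ξ.r_eq_r_iff, ← sub_one_mul,
      mul_inv_cancel_left₀ hne] at hr
    exact hr
  exact Units.ext (by rw [← hb, hb1, Units.val_one])

/-- **Shimura 1998 Thm. 19.11, first assertion, as an equivalence from the inertia hypothesis** (sibling of A-p03's
`forall_localUnits_eq_one_iff_hasGoodReductionAt_of_torsionReciprocity`; Serre–Tate 1968 §7 Thm. 11 Cor. 1 «`A` has good reduction at `v`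
if and only if `ε` is unramified at `v`»): `α(𝔬_v^×) = 1` iff `A₀` has good reduction at `v`, GIVEN the converse half of
Néron–Ogg–Šafarevič (`h₃`) and the inertia form of its easy half (`h₁₂`).
[cite: Shimura1998, Thm. 19.11 (first assertion) p. 136, §19.9 (≈ p. 135), Lemma 19.3/19.5 p. 133, Thm. 19.8 p. 134]
[cite: SerreTate1968, §7 Thm. 11 Cor. 1 and §1 Thm. 1] [cite: LangANT1994, Ch. XI §4 Thm. 4] -/
theorem forall_localUnits_eq_one_iff_hasGoodReductionAt_of_torsionReciprocity_of_inertia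
    (hrec : ∀ (σ : ℂ ≃ₐ[k] ℂ) (x : ideleGroup k), IsArtinLift k x σ → ∀ u v : K,
      ideleMulEquiv (FiniteAdeleRing.unitEmbedding (𝓞 K) K (α x) *
          (reflexNormFinitePart K Φ (traceField Φ) (ideleRelNorm (↥(traceField Φ)) k x))⁻¹)
        (𝔞 : FractionalIdeal (𝓞 K)⁰ K) 𝔞.ne_zero (Submodule.Quotient.mk u) = Submodule.Quotient.mk v →
      σ • (A₀.pointsMulEquiv ℂ).symm (ξ.r u) = (A₀.pointsMulEquiv ℂ).symm (ξ.r v))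
    {v : HeightOneSpectrum (𝓞 k)}
    (hαv : ∀ u : (v.adicCompletionIntegers k)ˣ, ∃ b : 𝓞 K,
      (b : K) = α (localUnits v (Units.map ((v.adicCompletionIntegers k).subtype : _ →* _) u)))
    (h₁₂ : HasGoodReductionAt A₀.X A₀.dim v → ∀ (ℓ : ℕ) [Fact ℓ.Prime], (ℓ : 𝓞 k) ∉ v.asIdeal →
      ∃ 𝔓 ∈ v.primesAbove, ∀ σ ∈ 𝔓.inertia (Field.absoluteGaloisGroup k), A₀.tateRep ℓ σ = 1)
    (h₃ : AbelianVariety.hasGoodReductionAt_of_isUnramifiedAt A₀ v) :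
    (∀ u : (v.adicCompletionIntegers k)ˣ,
        α (localUnits v (Units.map ((v.adicCompletionIntegers k).subtype : _ →* _) u)) = 1) ↔
      HasGoodReductionAt A₀.X A₀.dim v :=
  ⟨hasGoodReductionAt_of_forall_localUnits_eq_one_of_torsionReciprocity ξ α hrec h₃,
    forall_localUnits_eq_one_of_hasGoodReductionAt_of_torsionReciprocity_of_inertia ξ α hrec hαv h₁₂⟩

end Main

end Literature.NumberTheory.ComplexMultiplication

end
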